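import Mathlib
import Summits.KontsevichZagierPeriods.KontsevichZagierPeriods.Theorems.SoloInformedLegendreGauss
import Summits.KontsevichZagierPeriods.KontsevichZagierPeriods.Theorems.SoloInformedDecidedHulls
import HarnessLib
import HarnessLib.Audit

/-!
# SoloInformed — Legendre relation XI: Landen's transformation holds in `P`

Solo-informed residency (s33), file XI of the Legendre chain.  From file X (Gauss's AGM step and
homogeneity as moves) and one more change of variables — `t = k'x/√(1−x²)` carrying
`K(k) = [(0,1), ((1−x²)(1−k²x²))^{-1/2}]` onto the AGM representation `G_{1,k'²}` on `(0,∞)`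
(`soloInformed_ellipticK_agm_move`) — we obtain

**THEOREM XIX (Landen's transformation in `P`; `soloInformed_landen`).** For every real algebraic
`0 < k < 1`,
  `⟦K(2√k/(1+k))⟧ = ⟦[pt, 1+k]⟧ · ⟦K(k)⟧`   in the Kontsevich–Zagier period ring `P`,
hence `K(2√k/(1+k)) = (1+k)·K(k)` (`soloInformed_landen_value`).

**COROLLARY (the CM relation at `k = √2 − 1`; `soloInformed_ellipticK_sqrtTwoSubOne_complementary`).**
At the singular modulus `k₂ = √2 − 1` (where `2√k/(1+k) = k'`): `⟦K'(k₂)⟧ = ⟦[pt, √2]⟧·⟦K(k₂)⟧`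
in `P`, so `K'/K = √2` is a theorem of the three rules — the discriminant-`−8` companion of the
lemniscatic `⟦K'⟧ = ⟦K⟧` at `k = 1/√2`.

References: J. Landen, Philos. Trans. 65 (1775) 283–289; C. F. Gauss, *Werke* III;
J. M. & P. B. Borwein, *Pi and the AGM* (1987), Thm 1.2 and § 4.5 (singular value `k₂ = √2−1`);
Whittaker–Watson § 22.42; this work (s33).
-/

noncomputable section

open MeasureTheory Set Filter
open scoped Classical

open Literature.NumberTheory.Transcendental Literature.NumberTheory.Transcendental.KZ
open Literature.ModelTheory.ExponentialFields

namespace Summit.KontsevichZagierPeriods.KontsevichZagierPeriods.Theorems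

/-! ### Move: `K(k)` onto the AGM representation `G_{1, k'²}` -/

/-- **The `K ↦ AGM` move.** For real algebraic `0 < μ < 1` the substitution
`t = √(1−μ)·x/√(1−x²)` (rule 2) carries `[(0,1), ((1−x²)(1−μx²))^{-1/2}]` onto
`G_{1,1−μ} = [(0,∞), ((1+t²)((1−μ)+t²))^{-1/2}]`:  `1 + t² = (1−μx²)/(1−x²)`,
`(1−μ) + t² = (1−μ)/(1−x²)`, `dt/dx = √(1−μ)(1−x²)^{-3/2}`. [W–W § 22.72; this work] -/
theorem soloInformed_ellipticK_agm_move (μ : ℝ) (hμ : μ ∈ Ioo (0:ℝ) 1) (hμa : IsAlgebraic ℚ μ)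
    (K G : IntegralRep 1)
    (hKd : K.domain = {x : Fin 1 → ℝ | x 0 ∈ Ioo (0:ℝ) 1})
    (hKi : EqOn K.integrand
      (fun x => (√(1 - x 0 ^ 2))⁻¹ * (√(1 - μ * x 0 ^ 2))⁻¹) K.domain)
    (hGd : G.domain = {x : Fin 1 → ℝ | x 0 ∈ Ioi (0:ℝ)})
    (hGi : ∀ x, G.integrand x = (√(1 + x 0 ^ 2))⁻¹ * (√((1 - μ) + x 0 ^ 2))⁻¹) :
    of K - of G ∈ changeOfVariablesRel := by
  have hsq := BallPeeling.isSemialgebraic_posIoo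
  set c : ℝ := √(1 - μ) with hc
  have hc0 : 0 < c := Real.sqrt_pos.2 (by linarith [hμ.2])
  have hc2 : c ^ 2 = 1 - μ := Real.sq_sqrt (by linarith [hμ.2])
  have hca : IsAlgebraic ℚ c :=
    IsAlgebraic.of_pow two_pos (by rw [hc2]; exact isAlgebraic_one.sub hμa)
  have hrad : ∀ t ∈ Ioo (0:ℝ) 1, 0 < 1 - t ^ 2 := fun t ht => by nlinarith [ht.1, ht.2]
  -- strict monotonicity of `x ↦ x/√(1−x²)` on `(0,1)`
  have hsm : ∀ a ∈ Ioo (0:ℝ) 1, ∀ b ∈ Ioo (0:ℝ) 1, a < b →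
      a * (√(1 - a ^ 2))⁻¹ < b * (√(1 - b ^ 2))⁻¹ := by
    intro a ha b hb hab
    have hpa : 0 < √(1 - a ^ 2) := Real.sqrt_pos.2 (hrad a ha)
    have hpb : 0 < √(1 - b ^ 2) := Real.sqrt_pos.2 (hrad b hb)
    refine mul_lt_mul'' hab ((inv_lt_inv₀ hpa hpb).2 ?_) ha.1.le (inv_pos.2 hpa).le
    exact Real.sqrt_lt_sqrt (hrad b hb).le (by nlinarith [ha.1, hb.1])
  refine soloInformed_lift_mem_changeOfVariablesRel K G
    (g := fun x => c * (x * (√(1 - x ^ 2))⁻¹))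
    (g' := fun x => c * ((√(1 - x ^ 2))⁻¹ / (1 - x ^ 2)))
    (S := Ioo (0:ℝ) 1) (T := Ioi (0:ℝ)) hKd hGd ?_ (fun t ht => ?_) ?_ ?_ ?_
  · -- semialgebraicity of the substitution
    rw [hKd]
    refine IsSemialgebraicMapOn.of_forall hsq fun j => ?_
    refine ((isSemialgebraicFunOn_const_of_isAlgebraic hsq hca).mul_holds
      ((isSemialgebraicFunOn_aeval hsq (MvPolynomial.X 0)).mul_holds
        soloInformed_sa_arcsine)).congr fun x _ => ?_
    simp only [Pi.mul_apply, MvPolynomial.aeval_X, soloInformedLift]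
  · -- derivative
    have h0 := hrad t ht
    have h1 : HasDerivAt (fun y : ℝ => 1 - y ^ 2) (-(2 * t)) t :=
      (soloInformed_hasDerivAt_sq t).const_sub 1
    have h2 := soloInformed_hasDerivAt_inv_sqrt h1 h0 (t / (1 - t ^ 2))
      (by field_simp)
    have h3 := ((hasDerivAt_id' t).mul h2).const_mul c
    refine h3.congr_deriv ?_
    have hw : √(1 - t ^ 2) ≠ 0 := (Real.sqrt_pos.2 h0).ne'
    have hw2 : √(1 - t ^ 2) ^ 2 = 1 - t ^ 2 := Real.sq_sqrt h0.le
    field_simp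
    nlinarith [hw2]
  · -- injectivity
    intro a ha b hb h
    have h' : a * (√(1 - a ^ 2))⁻¹ = b * (√(1 - b ^ 2))⁻¹ := mul_left_cancel₀ hc0.ne' h
    by_contra hne
    rcases lt_or_gt_of_ne hne with hlt | hlt
    · exact (hsm a ha b hb hlt).ne h'
    · exact (hsm b hb a ha hlt).ne h'.symm
  · -- image `= (0,∞)`
    ext y
    constructor
    · rintro ⟨x, hx, rfl⟩
      have hpx : 0 < √(1 - x ^ 2) := Real.sqrt_pos.2 (hrad x hx)
      show (0:ℝ) < c * (x * (√(1 - x ^ 2))⁻¹)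
      exact mul_pos hc0 (mul_pos hx.1 (inv_pos.2 hpx))
    · intro hy
      have hy0 : (0:ℝ) < y := hy
      set s : ℝ := √(c ^ 2 + y ^ 2) with hs
      have hs0 : 0 < s := Real.sqrt_pos.2 (by positivity)
      have hs2 : s ^ 2 = c ^ 2 + y ^ 2 := Real.sq_sqrt (by positivity)
      have hys : y < s := by
        rw [hs, Real.lt_sqrt hy0.le]
        nlinarith
      have hx1 : y / s < 1 := (div_lt_one hs0).2 hys
      have hx0 : 0 < y / s := div_pos hy0 hs0
      refine ⟨y / s, ⟨hx0, hx1⟩, ?_⟩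
      have hw : 1 - (y / s) ^ 2 = c ^ 2 / s ^ 2 := by
        field_simp
        nlinarith [hs2]
      show c * (y / s * (√(1 - (y / s) ^ 2))⁻¹) = y
      rw [hw, Real.sqrt_div' _ (sq_nonneg _), Real.sqrt_sq hc0.le, Real.sqrt_sq hs0.le]
      field_simp
  · -- the integrand identity
    intro x hx
    have ht : x 0 ∈ Ioo (0:ℝ) 1 := by rw [hKd] at hx; exact hx
    have h0 := hrad (x 0) ht
    have hm0 : 0 < 1 - μ * x 0 ^ 2 := by nlinarith [hμ.1, hμ.2, ht.1, ht.2]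
    have hw : √(1 - x 0 ^ 2) ≠ 0 := (Real.sqrt_pos.2 h0).ne'
    have hwm : √(1 - μ * x 0 ^ 2) ≠ 0 := (Real.sqrt_pos.2 hm0).ne'
    have hw2 : √(1 - x 0 ^ 2) ^ 2 = 1 - x 0 ^ 2 := Real.sq_sqrt h0.le
    rw [hKi hx, hGi]
    simp only [soloInformedLift]
    have e1 : 1 + (c * (x 0 * (√(1 - x 0 ^ 2))⁻¹)) ^ 2 = (1 - μ * x 0 ^ 2) / (1 - x 0 ^ 2) := by
      field_simp
      rw [hw2, hc2]
      ring
    have e2 : 1 - μ + (c * (x 0 * (√(1 - x 0 ^ 2))⁻¹)) ^ 2 = c ^ 2 / (1 - x 0 ^ 2) := by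
      field_simp
      rw [hw2, ← hc2]
      ring
    rw [e1, e2, Real.sqrt_div' _ h0.le, Real.sqrt_div' _ h0.le, Real.sqrt_sq hc0.le,
      abs_of_pos (mul_pos hc0 (div_pos (inv_pos.2 (Real.sqrt_pos.2 h0)) h0))]
    field_simp
    rw [hw2]

/-- **`⟦K(k)⟧ = ⟦G_{1,k'²}⟧` in `P`.** [this work] -/
theorem soloInformed_ellipticK_eq_agm (μ : ℝ) (hμ : μ ∈ Ioo (0:ℝ) 1) (hμa : IsAlgebraic ℚ μ)
    (K G : IntegralRep 1)
    (hKd : K.domain = {x : Fin 1 → ℝ | x 0 ∈ Ioo (0:ℝ) 1})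
    (hKi : EqOn K.integrand
      (fun x => (√(1 - x 0 ^ 2))⁻¹ * (√(1 - μ * x 0 ^ 2))⁻¹) K.domain)
    (hGd : G.domain = {x : Fin 1 → ℝ | x 0 ∈ Ioi (0:ℝ)})
    (hGi : ∀ x, G.integrand x = (√(1 + x 0 ^ 2))⁻¹ * (√((1 - μ) + x 0 ^ 2))⁻¹) :
    toFormalPeriod (of K) = toFormalPeriod (of G) :=
  toFormalPeriod_eq_iff.mpr (changeOfVariablesRel_subset_relations
    (soloInformed_ellipticK_agm_move μ hμ hμa K G hKd hKi hGd hGi))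

/-! ### THEOREM XIX — Landen's transformation in `P` -/

/-- **THEOREM XIX (Landen's transformation is a theorem of the calculus).** For real algebraic
`0 < k < 1` and representations `K = [(0,1), ((1−x²)(1−k²x²))^{-1/2}]`,
`K₁ = [(0,1), ((1−x²)(1−k₁²x²))^{-1/2}]` with `k₁² = 4k/(1+k)²` (`k₁ = 2√k/(1+k)`):
  `⟦K₁⟧ = ⟦[pt, 1+k]⟧ · ⟦K⟧` in `P`.
Moves: `K ∼ G_{1,1−k²}`, `K₁ ∼ G_{1,((1−k)/(1+k))²}` (`soloInformed_ellipticK_agm_move`);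
homogeneity `G_{(1+k)/(1−k),(1−k)/(1+k)} = [pt,√((1−k)/(1+k))]·G_{1,((1−k)/(1+k))²}` and
`G_{1/(1−k²),1} = [pt,k']·G_{1,1−k²}`; Gauss's step `G_{(1+k)/(1−k),(1−k)/(1+k)} ∼ G_{1/(1−k²),1}`
(file X); and `√((1+k)/(1−k))·k' = 1+k`. [Landen 1775; Gauss 1799; this work] -/
theorem soloInformed_landen (k : ℝ) (hk : k ∈ Ioo (0:ℝ) 1) (hka : IsAlgebraic ℚ k)
    (K K₁ : IntegralRep 1)
    (hKd : K.domain = {x : Fin 1 → ℝ | x 0 ∈ Ioo (0:ℝ) 1})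
    (hKi : EqOn K.integrand
      (fun x => (√(1 - x 0 ^ 2))⁻¹ * (√(1 - k ^ 2 * x 0 ^ 2))⁻¹) K.domain)
    (hK₁d : K₁.domain = {x : Fin 1 → ℝ | x 0 ∈ Ioo (0:ℝ) 1})
    (hK₁i : EqOn K₁.integrand
      (fun x => (√(1 - x 0 ^ 2))⁻¹ * (√(1 - (4 * k / (1 + k) ^ 2) * x 0 ^ 2))⁻¹) K₁.domain)
    (h1k : IsAlgebraic ℚ (1 + k)) :
    toFormalPeriod (of K₁) =
      toFormalPeriod (of (IntegralRep.unit.constMul (1 + k) h1k)) * toFormalPeriod (of K) := by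
  obtain ⟨hk0, hk1⟩ := hk
  have h1k0 : 0 < 1 + k := by linarith
  have h1k' : 0 < 1 - k := by linarith
  have hkk : 0 < 1 - k ^ 2 := by nlinarith
  -- the parameters
  set A : ℝ := (1 + k) / (1 - k) with hA
  set B : ℝ := (1 - k) / (1 + k) with hB
  have hA0 : 0 < A := div_pos h1k0 h1k'
  have hB0 : 0 < B := div_pos h1k' h1k0
  have hAB : A * B = 1 := by rw [hA, hB]; field_simp
  have h1ka' : IsAlgebraic ℚ (1 - k) := isAlgebraic_one.sub hka
  have hAa : IsAlgebraic ℚ A := h1k.mul h1ka'.inv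
  have hBa : IsAlgebraic ℚ B := h1ka'.mul h1k.inv
  have hμ : k ^ 2 ∈ Ioo (0:ℝ) 1 := ⟨by positivity, by nlinarith⟩
  have hμa : IsAlgebraic ℚ (k ^ 2) := hka.pow 2
  have hμ₁ : 4 * k / (1 + k) ^ 2 ∈ Ioo (0:ℝ) 1 := by
    refine ⟨by positivity, (div_lt_one (by positivity)).2 ?_⟩
    nlinarith [sq_pos_of_pos h1k']
  have hμ₁a : IsAlgebraic ℚ (4 * k / (1 + k) ^ 2) :=
    ((isAlgebraic_nat (R := ℚ) (A := ℝ) 4).mul hka).mul (h1k.pow 2).inv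
  have hB₁ : 1 - 4 * k / (1 + k) ^ 2 = B ^ 2 := by rw [hB]; field_simp; ring
  have hkka : IsAlgebraic ℚ (1 - k ^ 2) := isAlgebraic_one.sub hμa
  -- the scaling constants `λ = √A`, `k' = √(1−k²)`
  set l : ℝ := √A with hl
  have hl0 : 0 < l := Real.sqrt_pos.2 hA0
  have hl2 : l ^ 2 = A := Real.sq_sqrt hA0.le
  have hla : IsAlgebraic ℚ l := IsAlgebraic.of_pow two_pos (by rw [hl2]; exact hAa)
  have hlia : IsAlgebraic ℚ l⁻¹ := hla.inv
  set k' : ℝ := √(1 - k ^ 2) with hk'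
  have hk'0 : 0 < k' := Real.sqrt_pos.2 hkk
  have hk'2 : k' ^ 2 = 1 - k ^ 2 := Real.sq_sqrt hkk.le
  have hk'a : IsAlgebraic ℚ k' := IsAlgebraic.of_pow two_pos (by rw [hk'2]; exact hkka)
  have hν0 : 0 < k'⁻¹ := inv_pos.2 hk'0
  have hνa : IsAlgebraic ℚ k'⁻¹ := hk'a.inv
  have hνia : IsAlgebraic ℚ k'⁻¹⁻¹ := by rw [inv_inv]; exact hk'a
  -- the AGM representations
  obtain ⟨G, hGd, hGi⟩ := soloInformed_exists_agm_rep one_pos hkk isAlgebraic_one hkka (Ioi (0:ℝ))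
    soloInformed_isSemialgebraic_Ioi_zero
  obtain ⟨G₁, hG₁d, hG₁i⟩ := soloInformed_exists_agm_rep one_pos (pow_pos hB0 2) isAlgebraic_one
    (hBa.pow 2) (Ioi (0:ℝ)) soloInformed_isSemialgebraic_Ioi_zero
  obtain ⟨GAB, hGABd, hGABi⟩ := soloInformed_exists_agm_rep hA0 hB0 hAa hBa (Ioi (0:ℝ))
    soloInformed_isSemialgebraic_Ioi_zero
  obtain ⟨GN, hGNd, hGNi⟩ := soloInformed_exists_agm_rep (inv_pos.2 hkk) one_pos hkka.inv
    isAlgebraic_one (Ioi (0:ℝ)) soloInformed_isSemialgebraic_Ioi_zero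
  -- (1) `K ∼ G_{1,1−k²}`, `K₁ ∼ G_{1,B²}`
  have e1 : toFormalPeriod (of K) = toFormalPeriod (of G) :=
    soloInformed_ellipticK_eq_agm (k ^ 2) hμ hμa K G hKd hKi hGd hGi
  have e2 : toFormalPeriod (of K₁) = toFormalPeriod (of G₁) :=
    soloInformed_ellipticK_eq_agm _ hμ₁ hμ₁a K₁ G₁ hK₁d hK₁i hG₁d fun x => by rw [hG₁i, hB₁]
  -- (2) homogeneity: `G_{A,B} = [pt, λ⁻¹]·G_{1,B²}` (`λ² = A`, `λ²B² = B`)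
  have e3 : toFormalPeriod (of GAB) =
      toFormalPeriod (of (IntegralRep.unit.constMul l⁻¹ hlia)) * toFormalPeriod (of G₁) := by
    refine soloInformed_agm_homogeneity one_pos (pow_pos hB0 2) hl0 hla hlia G₁ GAB hG₁d hG₁i
      hGABd fun x => ?_
    rw [hGABi, hl2, mul_one, show A * B ^ 2 = B by
      rw [show A * B ^ 2 = (A * B) * B by ring, hAB, one_mul]]
  -- (3) homogeneity: `G_{1/(1−k²),1} = [pt, k']·G_{1,1−k²}` (`ν = 1/k'`)
  have e4 : toFormalPeriod (of GN) =
      toFormalPeriod (of (IntegralRep.unit.constMul k'⁻¹⁻¹ hνia)) * toFormalPeriod (of G) := by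
    refine soloInformed_agm_homogeneity one_pos hkk hν0 hνa hνia G GN hGd hGi hGNd fun x => ?_
    rw [hGNi, inv_pow, hk'2, mul_one, inv_mul_cancel₀ hkk.ne']
  -- (4) Gauss: `G_{A,B} ∼ G_{1/(1−k²),1}` (`(A+B+2)/4 = 1/(1−k²)`)
  have hABk : (A + B + 2) / 4 = (1 - k ^ 2)⁻¹ := by
    rw [hA, hB]
    field_simp
    ring
  have e5 : toFormalPeriod (of GAB) = toFormalPeriod (of GN) :=
    toFormalPeriod_eq_iff.mpr (soloInformed_gauss_agm_step hA0 hB0 hAa hBa hAB GAB GN hGABd hGABi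
      hGNd fun x => by rw [hGNi, hABk])
  -- (5) assemble: `[pt,λ⁻¹]·⟦K₁⟧ = [pt,k']·⟦K⟧`, `λ·k' = 1 + k`
  have hlk : l * k' = 1 + k := by
    rw [hl, hk', ← Real.sqrt_mul hA0.le, hA, show (1 + k) / (1 - k) * (1 - k ^ 2) = (1 + k) ^ 2 by
      field_simp; ring, Real.sqrt_sq h1k0.le]
  have hpt : toFormalPeriod (of (IntegralRep.unit.constMul (1 + k) h1k)) =
      toFormalPeriod (of (IntegralRep.unit.constMul l hla)) *
        toFormalPeriod (of (IntegralRep.unit.constMul k'⁻¹⁻¹ hνia)) := by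
    rw [soloInformed_pointRep_mul l k'⁻¹⁻¹ hla hνia (by rw [inv_inv, hlk]; exact h1k)]
    exact soloInformed_pointRep_congr _ _ (by rw [inv_inv, hlk])
  have hll : toFormalPeriod (of (IntegralRep.unit.constMul l hla)) *
      toFormalPeriod (of (IntegralRep.unit.constMul l⁻¹ hlia)) = 1 := by
    rw [mul_comm]; exact soloInformed_pointRep_inv_mul l hla hl0.ne' hlia
  calc toFormalPeriod (of K₁) = toFormalPeriod (of G₁) := e2
    _ = (toFormalPeriod (of (IntegralRep.unit.constMul l hla)) *
          toFormalPeriod (of (IntegralRep.unit.constMul l⁻¹ hlia))) * toFormalPeriod (of G₁) := by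
        rw [hll, one_mul]
    _ = toFormalPeriod (of (IntegralRep.unit.constMul l hla)) * toFormalPeriod (of GAB) := by
        rw [mul_assoc, e3]
    _ = toFormalPeriod (of (IntegralRep.unit.constMul l hla)) *
          (toFormalPeriod (of (IntegralRep.unit.constMul k'⁻¹⁻¹ hνia)) * toFormalPeriod (of G)) := by
        rw [e5, e4]
    _ = toFormalPeriod (of (IntegralRep.unit.constMul (1 + k) h1k)) * toFormalPeriod (of K) := by
        rw [← mul_assoc, ← hpt, e1]

/-- **Landen's transformation, value form**: `K(2√k/(1+k)) = (1+k)·K(k)`. [Landen 1775] -/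
theorem soloInformed_landen_value (k : ℝ) (hk : k ∈ Ioo (0:ℝ) 1) (hka : IsAlgebraic ℚ k)
    (K K₁ : IntegralRep 1)
    (hKd : K.domain = {x : Fin 1 → ℝ | x 0 ∈ Ioo (0:ℝ) 1})
    (hKi : EqOn K.integrand
      (fun x => (√(1 - x 0 ^ 2))⁻¹ * (√(1 - k ^ 2 * x 0 ^ 2))⁻¹) K.domain)
    (hK₁d : K₁.domain = {x : Fin 1 → ℝ | x 0 ∈ Ioo (0:ℝ) 1})
    (hK₁i : EqOn K₁.integrand
      (fun x => (√(1 - x 0 ^ 2))⁻¹ * (√(1 - (4 * k / (1 + k) ^ 2) * x 0 ^ 2))⁻¹) K₁.domain) :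
    K₁.value = (1 + k) * K.value := by
  have h1k : IsAlgebraic ℚ (1 + k) := isAlgebraic_one.add hka
  have h := congrArg evalP (soloInformed_landen k hk hka K K₁ hKd hKi hK₁d hK₁i h1k)
  simpa [evalP_toFormalPeriod, map_mul, IntegralRep.value_constMul] using h

/-! ### COROLLARY — the CM relation `K' = √2·K` at `k = √2 − 1` holds in `P` -/

/-- **COROLLARY XIX.2 (complementary modulus at `k₂ = √2 − 1`).** At the singular modulus
`k = √2 − 1` one has `2√k/(1+k) = k'` (`4k/(1+k)² = 1 − k² = 2√2 − 2`), so Landen reads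
  `⟦K'(√2−1)⟧ = ⟦[pt, √2]⟧ · ⟦K(√2−1)⟧` in `P`:
the relation `K'/K = √2` of the imaginary quadratic order of discriminant `−8` is a theorem of
the three rules. [Borwein–Borwein 1987, § 4.5; this work] -/
theorem soloInformed_ellipticK_sqrtTwoSubOne_complementary (K K' : IntegralRep 1)
    (hKd : K.domain = {x : Fin 1 → ℝ | x 0 ∈ Ioo (0:ℝ) 1})
    (hKi : EqOn K.integrand
      (fun x => (√(1 - x 0 ^ 2))⁻¹ * (√(1 - (√2 - 1) ^ 2 * x 0 ^ 2))⁻¹) K.domain)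
    (hK'd : K'.domain = {x : Fin 1 → ℝ | x 0 ∈ Ioo (0:ℝ) 1})
    (hK'i : EqOn K'.integrand
      (fun x => (√(1 - x 0 ^ 2))⁻¹ * (√(1 - (1 - (√2 - 1) ^ 2) * x 0 ^ 2))⁻¹) K'.domain)
    (h2 : IsAlgebraic ℚ (√2 : ℝ)) :
    toFormalPeriod (of K') =
      toFormalPeriod (of (IntegralRep.unit.constMul (√2) h2)) * toFormalPeriod (of K) := by
  have hs2 : (√2 : ℝ) ^ 2 = 2 := Real.sq_sqrt (by norm_num)
  have hs1 : (1:ℝ) < √2 := by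
    have h := Real.sqrt_lt_sqrt (by norm_num : (0:ℝ) ≤ 1) (by norm_num : (1:ℝ) < 2)
    rwa [Real.sqrt_one] at h
  have hs3 : (√2 : ℝ) < 2 := by
    have h := Real.sqrt_lt_sqrt (by norm_num : (0:ℝ) ≤ 2) (by norm_num : (2:ℝ) < 4)
    rwa [show (4:ℝ) = 2 ^ 2 by norm_num, Real.sqrt_sq (by norm_num : (0:ℝ) ≤ 2)] at h
  have hk : (√2 - 1 : ℝ) ∈ Ioo (0:ℝ) 1 := ⟨by linarith, by linarith⟩
  have h2a : IsAlgebraic ℚ (√2 : ℝ) := h2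
  have hka : IsAlgebraic ℚ (√2 - 1 : ℝ) := h2a.sub isAlgebraic_one
  have hmod : 4 * (√2 - 1) / (1 + (√2 - 1)) ^ 2 = 1 - (√2 - 1) ^ 2 := by
    have : (1 + (√2 - 1) : ℝ) = √2 := by ring
    rw [this, hs2]
    nlinarith [hs2]
  have h1k : IsAlgebraic ℚ (1 + (√2 - 1) : ℝ) := by rw [add_sub_cancel]; exact h2
  have h := soloInformed_landen (√2 - 1) hk hka K K' hKd hKi hK'd
    (fun x hx => by rw [hK'i hx, hmod]) h1k
  rw [h]
  congr 1
  exact soloInformed_pointRep_congr _ _ (by ring)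

/-- **`K'(√2−1) = √2·K(√2−1)`** (value form). [Borwein–Borwein 1987, § 4.5] -/
theorem soloInformed_ellipticK_sqrtTwoSubOne_complementary_value (K K' : IntegralRep 1)
    (hKd : K.domain = {x : Fin 1 → ℝ | x 0 ∈ Ioo (0:ℝ) 1})
    (hKi : EqOn K.integrand
      (fun x => (√(1 - x 0 ^ 2))⁻¹ * (√(1 - (√2 - 1) ^ 2 * x 0 ^ 2))⁻¹) K.domain)
    (hK'd : K'.domain = {x : Fin 1 → ℝ | x 0 ∈ Ioo (0:ℝ) 1})
    (hK'i : EqOn K'.integrand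
      (fun x => (√(1 - x 0 ^ 2))⁻¹ * (√(1 - (1 - (√2 - 1) ^ 2) * x 0 ^ 2))⁻¹) K'.domain) :
    K'.value = √2 * K.value := by
  have h2 : IsAlgebraic ℚ (√2 : ℝ) := ⟨Polynomial.X ^ 2 - Polynomial.C 2,
    (Polynomial.monic_X_pow_sub_C (2 : ℚ) two_ne_zero).ne_zero, by simp [Real.sq_sqrt]⟩
  have h := congrArg evalP
    (soloInformed_ellipticK_sqrtTwoSubOne_complementary K K' hKd hKi hK'd hK'i h2)
  simpa [evalP_toFormalPeriod, map_mul, IntegralRep.value_constMul] using h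

end Summit.KontsevichZagierPeriods.KontsevichZagierPeriods.Theorems

end
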